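import Literature.MathematicalPhysics.QuantumLattice.DWaveOrderParameterTPrimeUCells
import Literature.MathematicalPhysics.QuantumLattice.HubbardTTPrimeTPPKinematicLipschitz
import HarnessLib

/-!
# The FIXED-FILLING (n-form) editions of the `U`-cell and `(t', U)`-rectangle pair-amplitude ceilings:
# one canonical cap at the member's filling, one sourced floor at a chemical potential `μ₀` of the producer's
# choice — no chemical-potential interval

Topic `Literature/MathematicalPhysics/QuantumLattice` (namespace = path; family `hubbard`). Sequel of
`DWaveOrderParameterUCells.lean` / `DWaveOrderParameterTPrimeUCells.lean` (hubbard-downfold-unc-1: member-local caps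
and chord floors on `U`-cells and `(t',U)`-rectangles), written for the n-FORM OF RECORD of the downfold order seam
(`Downfold.TppSeamOrderFilling`, hubbard-downfold-mod-1: a material box carries the FILLING `n`, and the variational
argument runs against translation-invariant states OF DENSITY `n` with the sourced grand-canonical principle read
at the anchor's own `μ₀` — «no transport in `μ`, no interval»; its remedy (iii) «`U`-cells if the window `R − L`
is too wide» is what this file serves). For a translation-invariant `σ` with `σ.density = n` whose source-free
object-M mean energy at `(1, s, t'', U)` is within `ε` of the canonical minimum
`e^M_n := tiGroundEnergyDensityAt (hubbardTT'T''FermionInteraction 1 s t'' U) 2 n`,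

  `h·e_P(σ) = E_M(σ) − μ₀ n − E^{src}_{μ₀,h}(σ) ≤ [e^M_n + ε] − μ₀ n − e^M_src(s, t'', U, μ₀, h)`

(affinity `meanEnergy_hubbardTT'T''Sourced` + the grand-canonical variational principle at `(μ₀, h)`), and the two
object-M quantities are tied to object E by the `t''`-seams (`16/π²` per unit of `|t''|` each:
`abs_tiGroundEnergyDensityAt_tpp_sub_le_kinematic`, `tiGroundEnergyDensity_tppSourced_ge_of_le`). Hence every
MEMBER-LOCAL cap on the canonical `t–t'` density `e(1,s,U,n)` and every floor on the sourced density `E(s,U,μ₀,h)`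
of the two cell files produce an n-form pair-amplitude ceiling:

* §1 the master step at one point: `e_P(σ) ≤ (C − μ₀n − F + (32/π²)|t''| + ε)/h` from a canonical cap
  `e(1,s,U,n) ≤ C` and a sourced floor `F ≤ E(s,U,μ₀,h)` AT THE SAME `(s,U)`;
* §2 the `U`-CELL: `C = min(R₁ + A(U − U₁), R₂ − B(U₂ − U))` (canonical docc rows) and `F = chord(lo₁,lo₂;U)` (sourced
  floors at BOTH ends, at `μ₀`) — bulge / ABSENT forms; row-free chain edition;
* §3 the `(t',U)`-RECTANGLE: `C = min` of the four canonical corner planes, `F =` the bilinear chord floor; uniform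
  NESTED BULGE and ABSENT(`< m₀`) on the whole rectangle — the drop-in for `holdsOn_pairAmplitude_le_of_anchor_filling`
  with the cell-wide `R` replaced by member-local caps and the single lower-edge floor by the two-anchor chord.

HONEST SCOPE: variational, ceiling/ABSENT side only; `e_P(σ)` of translation-invariant near-minimisers is the
surrogate of the (undefined in the tree) order parameter of object M; nothing here floors order or bears on `T_c`;
every output is conditional on the corner certificates fed in; no sourced producer exists today. Everything is
PROVED; no definition, no named fact, zero compute, no `sorry`.

## References
* T. Koma, H. Tasaki, J. Stat. Phys. 76 (1994) 745–803, §1 (secant bound on the induced pair amplitude).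
  [cite: KomaTasaki1994, §1]
* R. B. Israel, *Convexity in the Theory of Lattice Gases* (1979), Thm. I.3.4. [cite: Israel1979, Thm. I.3.4]
* D. Ruelle, *Statistical Mechanics: Rigorous Results* (1969), §3.4 (canonical vs grand-canonical variational
  principles). [cite: Ruelle1969, §3.4]
* R. B. Griffiths, J. Math. Phys. 5 (1964) 1215, §II. [cite: Griffiths1964, §II]
-/

noncomputable section

namespace Literature.MathematicalPhysics.QuantumLattice

open _root_.Matrix Finset Set HubbardWave0 Literature.Probability.LatticeModels ThermodynamicLimit _root_.Filter
open scoped _root_.Topology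

/-! ### §1 The master step at one point -/

section Master

/-- **Object-M canonical minimum under a `t–t'` cap**: `e(1,s,U,n) ≤ C` (`U ≥ 0`, `0 < n < 2`) gives
`e^M_n(1,s,t'',U) ≤ C + (16/π²)|t''|` (the fixed-filling `t''`-seam). [cite: Israel1979, Thm. I.3.4] -/
theorem tiGroundEnergyDensityAt_objectM_le_of_cap (s : ℝ) {U : ℝ} (hU : 0 ≤ U) {n : ℝ} (hn0 : 0 < n)
    (hn2 : n < 2) {C : ℝ} (hC : energyDensityTT' 1 s U n ≤ C) (t'' : ℝ) :
    (hubbardTT'T''FermionInteraction 1 s t'' U).tiGroundEnergyDensityAt 2 n ≤ C + 16 / Real.pi ^ 2 * |t''| := by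
  have h := (abs_sub_le_iff.1 (abs_tiGroundEnergyDensityAt_tpp_sub_le_kinematic 1 s U hn0 hn2 t'' 0)).1
  rw [tiGroundEnergyDensityAt_hubbardTT'T''_zero 1 s hU hn0 hn2, sub_zero] at h
  linarith

/-- **THE n-FORM MASTER STEP.** A canonical cap `e(1,s,U,n) ≤ C` and a sourced floor `F ≤ E(s,U,μ₀,h)` at the
SAME `(s,U)` (`U ≥ 0`, `0 < n < 2`, `h > 0`, any `μ₀`) give, for every translation-invariant `σ` with
`σ.density = n` whose source-free object-M mean energy at `(1,s,t'',U)` is within `ε` of the canonical minimum,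
`e_P(σ) ≤ (C − μ₀n − F + (32/π²)|t''| + ε)/h`. [cite: KomaTasaki1994, §1] -/
theorem meanEnergy_pairSource_le_of_cap_of_floor_filling (s : ℝ) {U : ℝ} (hU : 0 ≤ U) {n : ℝ} (hn0 : 0 < n)
    (hn2 : n < 2) {h : ℝ} (hh : 0 < h) (μ₀ : ℝ) {C F : ℝ} (hC : energyDensityTT' 1 s U n ≤ C)
    (hF : F ≤ dWaveSourceEnergyDensityTT' s U μ₀ h) (t'' : ℝ) {ε : ℝ} {σ : InfVolFermionState 2}
    (hσ : σ.IsTranslationInvariant) (hρ : σ.density = n)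
    (hε : σ.meanEnergy (hubbardTT'T''FermionInteraction 1 s t'' U) 2 ≤
      (hubbardTT'T''FermionInteraction 1 s t'' U).tiGroundEnergyDensityAt 2 n + ε) :
    σ.meanEnergy (pairSourceInteraction dWaveFormFactor) 1 ≤ (C - μ₀ * n - F + 32 / Real.pi ^ 2 * |t''| + ε) / h := by
  have hcap := tiGroundEnergyDensityAt_objectM_le_of_cap s hU hn0 hn2 hC t''
  have hvar := (hubbardTT'T''SourcedInteraction 1 s t'' U μ₀ dWaveFormFactor h).tiGroundEnergyDensity_le_meanEnergy 2 hσ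
  rw [σ.meanEnergy_hubbardTT'T''Sourced 1 s t'' U μ₀ dWaveFormFactor h, hρ] at hvar
  have hfl := tiGroundEnergyDensity_tppSourced_ge_of_le hF t''
  rw [le_div_iff₀ hh]
  have h32 : 32 / Real.pi ^ 2 * |t''| = 2 * (16 / Real.pi ^ 2 * |t''|) := by ring
  rw [h32]
  nlinarith

end Master

/-! ### §2 The `U`-cell, n-form -/

section UCell

/-- **n-FORM PAIR-AMPLITUDE CEILING ON A `U`-CELL** (canonical docc rows; sourced floors at `μ₀` at BOTH ends):
caps `e(1,s,Uᵢ,n) ≤ Rᵢ` (`0 ≤ U₁ < U₂`, `0 < n < 2`), a docc CEILING row `A` at `U₁`, a docc FLOOR row `B` at `U₂`,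
floors `loᵢ ≤ E(s,Uᵢ,μ₀,h)` (`h > 0`): for every `U ∈ [U₁,U₂]` and every translation-invariant `σ` of density `n`
that is an `ε`-near canonical minimiser of object M at `(1,s,t'',U)`,
`e_P(σ) ≤ (min(R₁ + A(U − U₁), R₂ − B(U₂ − U)) − μ₀n − chord(lo₁,lo₂;U) + (32/π²)|t''| + ε)/h`.
[cite: KomaTasaki1994, §1] -/
theorem meanEnergy_pairSource_le_of_U_interval_filling (s : ℝ) {U₁ U₂ : ℝ} (hU₁ : 0 ≤ U₁) (hlt : U₁ < U₂)
    {n : ℝ} (hn0 : 0 < n) (hn2 : n < 2) {h : ℝ} (hh : 0 < h) (μ₀ : ℝ) {R₁ R₂ A B lo₁ lo₂ : ℝ}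
    (hR₁ : energyDensityTT' 1 s U₁ n ≤ R₁) (hR₂ : energyDensityTT' 1 s U₂ n ≤ R₂)
    (hA : ∀ (ω : InfVolFermionState 2) (Ls : ℕ → ℕ) (ψ : ∀ L, Fock (Orb (FermionTorus 2 L))),
      Tendsto Ls atTop atTop →
      (∀ j, IsGroundStateInSector (hubbardTorusTT' (Ls j) 1 s U₁) (rectN n (Ls j)) 0 (ψ (Ls j))) →
      (∀ j, star (ψ (Ls j)) ⬝ᵥ ψ (Ls j) = 1) → ω.IsTorusLimitOf ψ Ls →
      (ω.expect ({0} : Finset (Site 2))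
          (nAt 0 (Finset.mem_singleton_self 0) 0 * nAt 0 (Finset.mem_singleton_self 0) 1)).re ≤ A)
    (hB : ∀ (ω : InfVolFermionState 2) (Ls : ℕ → ℕ) (ψ : ∀ L, Fock (Orb (FermionTorus 2 L))),
      Tendsto Ls atTop atTop →
      (∀ j, IsGroundStateInSector (hubbardTorusTT' (Ls j) 1 s U₂) (rectN n (Ls j)) 0 (ψ (Ls j))) →
      (∀ j, star (ψ (Ls j)) ⬝ᵥ ψ (Ls j) = 1) → ω.IsTorusLimitOf ψ Ls →
      B ≤ (ω.expect ({0} : Finset (Site 2))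
          (nAt 0 (Finset.mem_singleton_self 0) 0 * nAt 0 (Finset.mem_singleton_self 0) 1)).re)
    (hlo₁ : lo₁ ≤ dWaveSourceEnergyDensityTT' s U₁ μ₀ h) (hlo₂ : lo₂ ≤ dWaveSourceEnergyDensityTT' s U₂ μ₀ h)
    {U : ℝ} (h₁ : U₁ ≤ U) (h₂ : U ≤ U₂) (t'' : ℝ) {ε : ℝ} {σ : InfVolFermionState 2}
    (hσ : σ.IsTranslationInvariant) (hρ : σ.density = n)
    (hε : σ.meanEnergy (hubbardTT'T''FermionInteraction 1 s t'' U) 2 ≤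
      (hubbardTT'T''FermionInteraction 1 s t'' U).tiGroundEnergyDensityAt 2 n + ε) :
    σ.meanEnergy (pairSourceInteraction dWaveFormFactor) 1 ≤
      (min (R₁ + A * (U - U₁)) (R₂ - B * (U₂ - U)) - μ₀ * n - (lo₁ + (lo₂ - lo₁) * (U - U₁) / (U₂ - U₁)) +
        32 / Real.pi ^ 2 * |t''| + ε) / h :=
  meanEnergy_pairSource_le_of_cap_of_floor_filling s (hU₁.trans h₁) hn0 hn2 hh μ₀
    (energyDensityTT'_U_interval_le_min_tangents_of_doccWords 1 s hU₁ h₁ h₂ hn0.le hn2 hR₁ hR₂ hA hB)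
    (dWaveSourceEnergyDensityTT'_ge_U_chord hlt h₁ h₂ hlo₁ hlo₂) t'' hσ hρ hε

/-- **n-FORM, UNIFORM BULGE on the `U`-cell**: under the same data, with `gᵢ = Rᵢ − μ₀n − loᵢ`, `σ = (lo₂ − lo₁)/w`,
`e_P(σ) ≤ (max g₁ g₂ + (U₂ − U₁)·(A − σ)⁺(σ − B)⁺/((A − σ)⁺ + (σ − B)⁺) + (32/π²)|t''| + ε)/h` for every
`U ∈ [U₁,U₂]`. [cite: KomaTasaki1994, §1] -/
theorem meanEnergy_pairSource_le_bulge_of_U_interval_filling (s : ℝ) {U₁ U₂ : ℝ} (hU₁ : 0 ≤ U₁)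
    (hlt : U₁ < U₂) {n : ℝ} (hn0 : 0 < n) (hn2 : n < 2) {h : ℝ} (hh : 0 < h) (μ₀ : ℝ) {R₁ R₂ A B lo₁ lo₂ : ℝ}
    (hR₁ : energyDensityTT' 1 s U₁ n ≤ R₁) (hR₂ : energyDensityTT' 1 s U₂ n ≤ R₂)
    (hA : ∀ (ω : InfVolFermionState 2) (Ls : ℕ → ℕ) (ψ : ∀ L, Fock (Orb (FermionTorus 2 L))),
      Tendsto Ls atTop atTop →
      (∀ j, IsGroundStateInSector (hubbardTorusTT' (Ls j) 1 s U₁) (rectN n (Ls j)) 0 (ψ (Ls j))) →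
      (∀ j, star (ψ (Ls j)) ⬝ᵥ ψ (Ls j) = 1) → ω.IsTorusLimitOf ψ Ls →
      (ω.expect ({0} : Finset (Site 2))
          (nAt 0 (Finset.mem_singleton_self 0) 0 * nAt 0 (Finset.mem_singleton_self 0) 1)).re ≤ A)
    (hB : ∀ (ω : InfVolFermionState 2) (Ls : ℕ → ℕ) (ψ : ∀ L, Fock (Orb (FermionTorus 2 L))),
      Tendsto Ls atTop atTop →
      (∀ j, IsGroundStateInSector (hubbardTorusTT' (Ls j) 1 s U₂) (rectN n (Ls j)) 0 (ψ (Ls j))) →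
      (∀ j, star (ψ (Ls j)) ⬝ᵥ ψ (Ls j) = 1) → ω.IsTorusLimitOf ψ Ls →
      B ≤ (ω.expect ({0} : Finset (Site 2))
          (nAt 0 (Finset.mem_singleton_self 0) 0 * nAt 0 (Finset.mem_singleton_self 0) 1)).re)
    (hlo₁ : lo₁ ≤ dWaveSourceEnergyDensityTT' s U₁ μ₀ h) (hlo₂ : lo₂ ≤ dWaveSourceEnergyDensityTT' s U₂ μ₀ h)
    {U : ℝ} (h₁ : U₁ ≤ U) (h₂ : U ≤ U₂) (t'' : ℝ) {ε : ℝ} {σ : InfVolFermionState 2}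
    (hσ : σ.IsTranslationInvariant) (hρ : σ.density = n)
    (hε : σ.meanEnergy (hubbardTT'T''FermionInteraction 1 s t'' U) 2 ≤
      (hubbardTT'T''FermionInteraction 1 s t'' U).tiGroundEnergyDensityAt 2 n + ε) :
    σ.meanEnergy (pairSourceInteraction dWaveFormFactor) 1 ≤
      (max (R₁ - μ₀ * n - lo₁) (R₂ - μ₀ * n - lo₂) +
        (U₂ - U₁) * (max (A - (lo₂ - lo₁) / (U₂ - U₁)) 0 * max ((lo₂ - lo₁) / (U₂ - U₁) - B) 0) /
          (max (A - (lo₂ - lo₁) / (U₂ - U₁)) 0 + max ((lo₂ - lo₁) / (U₂ - U₁) - B) 0) +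
        32 / Real.pi ^ 2 * |t''| + ε) / h := by
  refine (meanEnergy_pairSource_le_of_U_interval_filling s hU₁ hlt hn0 hn2 hh μ₀ hR₁ hR₂ hA hB hlo₁ hlo₂ h₁ h₂
    t'' hσ hρ hε).trans (div_le_div_of_nonneg_right ?_ hh.le)
  have hb := min_tangents_sub_chord_le_bulge (hi₁ := R₁ - μ₀ * n) (hi₂ := R₂ - μ₀ * n) (lo₁ := lo₁) (lo₂ := lo₂)
    (A := A) (B := B) hlt h₁ h₂
  have e : min (R₁ + A * (U - U₁)) (R₂ - B * (U₂ - U)) - μ₀ * n =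
      min (R₁ - μ₀ * n + A * (U - U₁)) (R₂ - μ₀ * n - B * (U₂ - U)) := by
    rw [← min_sub_sub_right]
    congr 1 <;> ring
  linarith [hb, e]

/-- **n-FORM ABSENT(`< m₀`) ON A WHOLE `U`-CELL**: if
`max g₁ g₂ + (U₂ − U₁)·(A − σ)⁺(σ − B)⁺/((A − σ)⁺ + (σ − B)⁺) + (32/π²)|t''| < h·m₀` (`gᵢ = Rᵢ − μ₀n − loᵢ`) then
no translation-invariant CANONICAL minimiser of object M (density `n`, mean energy at the canonical minimum) at
any `(1,s,t'',U)`, `U ∈ [U₁,U₂]`, has `d`-wave pair amplitude `≥ m₀`. [cite: KomaTasaki1994, §1] -/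
theorem meanEnergy_pairSource_lt_on_U_interval_filling (s : ℝ) {U₁ U₂ : ℝ} (hU₁ : 0 ≤ U₁) (hlt : U₁ < U₂)
    {n : ℝ} (hn0 : 0 < n) (hn2 : n < 2) {h : ℝ} (hh : 0 < h) (μ₀ : ℝ) {R₁ R₂ A B lo₁ lo₂ m₀ : ℝ}
    (hR₁ : energyDensityTT' 1 s U₁ n ≤ R₁) (hR₂ : energyDensityTT' 1 s U₂ n ≤ R₂)
    (hA : ∀ (ω : InfVolFermionState 2) (Ls : ℕ → ℕ) (ψ : ∀ L, Fock (Orb (FermionTorus 2 L))),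
      Tendsto Ls atTop atTop →
      (∀ j, IsGroundStateInSector (hubbardTorusTT' (Ls j) 1 s U₁) (rectN n (Ls j)) 0 (ψ (Ls j))) →
      (∀ j, star (ψ (Ls j)) ⬝ᵥ ψ (Ls j) = 1) → ω.IsTorusLimitOf ψ Ls →
      (ω.expect ({0} : Finset (Site 2))
          (nAt 0 (Finset.mem_singleton_self 0) 0 * nAt 0 (Finset.mem_singleton_self 0) 1)).re ≤ A)
    (hB : ∀ (ω : InfVolFermionState 2) (Ls : ℕ → ℕ) (ψ : ∀ L, Fock (Orb (FermionTorus 2 L))),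
      Tendsto Ls atTop atTop →
      (∀ j, IsGroundStateInSector (hubbardTorusTT' (Ls j) 1 s U₂) (rectN n (Ls j)) 0 (ψ (Ls j))) →
      (∀ j, star (ψ (Ls j)) ⬝ᵥ ψ (Ls j) = 1) → ω.IsTorusLimitOf ψ Ls →
      B ≤ (ω.expect ({0} : Finset (Site 2))
          (nAt 0 (Finset.mem_singleton_self 0) 0 * nAt 0 (Finset.mem_singleton_self 0) 1)).re)
    (hlo₁ : lo₁ ≤ dWaveSourceEnergyDensityTT' s U₁ μ₀ h) (hlo₂ : lo₂ ≤ dWaveSourceEnergyDensityTT' s U₂ μ₀ h)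
    {t'' : ℝ}
    (hnear : max (R₁ - μ₀ * n - lo₁) (R₂ - μ₀ * n - lo₂) +
        (U₂ - U₁) * (max (A - (lo₂ - lo₁) / (U₂ - U₁)) 0 * max ((lo₂ - lo₁) / (U₂ - U₁) - B) 0) /
          (max (A - (lo₂ - lo₁) / (U₂ - U₁)) 0 + max ((lo₂ - lo₁) / (U₂ - U₁) - B) 0) +
        32 / Real.pi ^ 2 * |t''| < h * m₀)
    {U : ℝ} (h₁ : U₁ ≤ U) (h₂ : U ≤ U₂) {σ : InfVolFermionState 2} (hσ : σ.IsTranslationInvariant)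
    (hρ : σ.density = n)
    (hmin : σ.meanEnergy (hubbardTT'T''FermionInteraction 1 s t'' U) 2 ≤
      (hubbardTT'T''FermionInteraction 1 s t'' U).tiGroundEnergyDensityAt 2 n) :
    σ.meanEnergy (pairSourceInteraction dWaveFormFactor) 1 < m₀ := by
  have hk := meanEnergy_pairSource_le_bulge_of_U_interval_filling (ε := 0) s hU₁ hlt hn0 hn2 hh μ₀ hR₁ hR₂ hA hB
    hlo₁ hlo₂ h₁ h₂ t'' hσ hρ (by rw [add_zero]; exact hmin)
  rw [add_zero] at hk
  refine hk.trans_lt ?_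
  rw [div_lt_iff₀ hh]
  linarith [hnear]

/-- **n-FORM ON AN INTERIOR CELL OF A `U`-CHAIN, row-free** (the neighbours' secant slopes as docc words, §8 of the
`U`-cell file): canonical energy rows `L₀ ≤ e(1,s,U₀,n)`, `e(1,s,U₁,n) ≤ R₁`, `e(1,s,U₂,n) ≤ R₂`, `L₃ ≤ e(1,s,U₃,n)`
on `0 ≤ U₀ < U₁ < U₂ < U₃` and sourced floors `loᵢ ≤ E(s,Uᵢ,μ₀,h)` give, for every `U ∈ [U₁,U₂]`,
`e_P(σ) ≤ (min(R₁ + (U − U₁)(R₁ − L₀)/(U₁ − U₀), R₂ − (U₂ − U)(L₃ − R₂)/(U₃ − U₂)) − μ₀n − chord(lo₁,lo₂;U)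
  + (32/π²)|t''| + ε)/h`. [cite: KomaTasaki1994, §1] -/
theorem meanEnergy_pairSource_le_of_U_chain_filling (s : ℝ) {U₀ U₁ U₂ U₃ : ℝ} (hU₀ : 0 ≤ U₀) (h01 : U₀ < U₁)
    (h12 : U₁ < U₂) (h23 : U₂ < U₃) {n : ℝ} (hn0 : 0 < n) (hn2 : n < 2) {h : ℝ} (hh : 0 < h) (μ₀ : ℝ)
    {L₀ R₁ R₂ L₃ lo₁ lo₂ : ℝ} (hL₀ : L₀ ≤ energyDensityTT' 1 s U₀ n) (hR₁ : energyDensityTT' 1 s U₁ n ≤ R₁)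
    (hR₂ : energyDensityTT' 1 s U₂ n ≤ R₂) (hL₃ : L₃ ≤ energyDensityTT' 1 s U₃ n)
    (hlo₁ : lo₁ ≤ dWaveSourceEnergyDensityTT' s U₁ μ₀ h) (hlo₂ : lo₂ ≤ dWaveSourceEnergyDensityTT' s U₂ μ₀ h)
    {U : ℝ} (h₁ : U₁ ≤ U) (h₂ : U ≤ U₂) (t'' : ℝ) {ε : ℝ} {σ : InfVolFermionState 2}
    (hσ : σ.IsTranslationInvariant) (hρ : σ.density = n)
    (hε : σ.meanEnergy (hubbardTT'T''FermionInteraction 1 s t'' U) 2 ≤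
      (hubbardTT'T''FermionInteraction 1 s t'' U).tiGroundEnergyDensityAt 2 n + ε) :
    σ.meanEnergy (pairSourceInteraction dWaveFormFactor) 1 ≤
      (min (R₁ + (R₁ - L₀) / (U₁ - U₀) * (U - U₁)) (R₂ - (L₃ - R₂) / (U₃ - U₂) * (U₂ - U)) - μ₀ * n -
          (lo₁ + (lo₂ - lo₁) * (U - U₁) / (U₂ - U₁)) +
        32 / Real.pi ^ 2 * |t''| + ε) / h :=
  meanEnergy_pairSource_le_of_U_interval_filling s (hU₀.trans h01.le) h12 hn0 hn2 hh μ₀ hR₁ hR₂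
    (forall_isTorusLimitOf_docc_le_secant 1 s hU₀ h01 hn0.le hn2 hL₀ hR₁)
    (forall_isTorusLimitOf_secant_le_docc 1 s ((hU₀.trans h01.le).trans h12.le) h23 hn0.le hn2 hR₂ hL₃) hlo₁ hlo₂ h₁
    h₂ t'' hσ hρ hε

end UCell

/-! ### §3 The `(t', U)`-rectangle, n-form -/

section Rect

/-- **n-FORM PAIR-AMPLITUDE CEILING ON A `(t', U)` RECTANGLE, pointwise** (canonical corner words; sourced floors at
`μ₀` at the four corners): for every `(t',U) ∈ [s₁,s₂] × [U₁,U₂]` (`0 ≤ U₁`, `s₁ < s₂`, `U₁ < U₂`, `0 < n < 2`) and every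
translation-invariant `σ` of density `n` that is an `ε`-near canonical minimiser of object M at `(1,t',t'',U)`,
`e_P(σ) ≤ (min(min P₁₁ P₁₂, min P₂₁ P₂₂)(t',U) − μ₀n − bilinear(lo;t',U) + (32/π²)|t''| + ε)/h`.
[cite: KomaTasaki1994, §1] -/
theorem meanEnergy_pairSource_le_of_rect_filling {s₁ s₂ U₁ U₂ : ℝ} (hU₁0 : 0 ≤ U₁) (hs : s₁ < s₂)
    (hUlt : U₁ < U₂) {n : ℝ} (hn0 : 0 < n) (hn2 : n < 2) {h : ℝ} (hh : 0 < h) (μ₀ : ℝ)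
    {R₁₁ R₂₁ R₁₂ R₂₂ lo₁₁ lo₂₁ lo₁₂ lo₂₂ K₁₁ K₁₂ J₂₁ J₂₂ A₁₁ A₂₁ B₁₂ B₂₂ : ℝ}
    (hR₁₁ : energyDensityTT' 1 s₁ U₁ n ≤ R₁₁) (hR₂₁ : energyDensityTT' 1 s₂ U₁ n ≤ R₂₁)
    (hR₁₂ : energyDensityTT' 1 s₁ U₂ n ≤ R₁₂) (hR₂₂ : energyDensityTT' 1 s₂ U₂ n ≤ R₂₂)
    (h₁₁ : ∀ (ω : InfVolFermionState 2) (Ls : ℕ → ℕ) (ψ : ∀ L, Fock (Orb (FermionTorus 2 L))),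
      Tendsto Ls atTop atTop →
      (∀ j, IsGroundStateInSector (hubbardTorusTT' (Ls j) 1 s₁ U₁) (rectN n (Ls j)) 0 (ψ (Ls j))) →
      (∀ j, star (ψ (Ls j)) ⬝ᵥ ψ (Ls j) = 1) → ω.IsTorusLimitOf ψ Ls →
      ω.meanEnergy (hubbardTTPrimeFermionInteraction 0 1 0) 1 ≤ K₁₁ ∧
        (ω.expect ({0} : Finset (Site 2))
          (nAt 0 (Finset.mem_singleton_self 0) 0 * nAt 0 (Finset.mem_singleton_self 0) 1)).re ≤ A₁₁)
    (h₁₂ : ∀ (ω : InfVolFermionState 2) (Ls : ℕ → ℕ) (ψ : ∀ L, Fock (Orb (FermionTorus 2 L))),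
      Tendsto Ls atTop atTop →
      (∀ j, IsGroundStateInSector (hubbardTorusTT' (Ls j) 1 s₁ U₂) (rectN n (Ls j)) 0 (ψ (Ls j))) →
      (∀ j, star (ψ (Ls j)) ⬝ᵥ ψ (Ls j) = 1) → ω.IsTorusLimitOf ψ Ls →
      ω.meanEnergy (hubbardTTPrimeFermionInteraction 0 1 0) 1 ≤ K₁₂ ∧
        B₁₂ ≤ (ω.expect ({0} : Finset (Site 2))
          (nAt 0 (Finset.mem_singleton_self 0) 0 * nAt 0 (Finset.mem_singleton_self 0) 1)).re)
    (h₂₁ : ∀ (ω : InfVolFermionState 2) (Ls : ℕ → ℕ) (ψ : ∀ L, Fock (Orb (FermionTorus 2 L))),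
      Tendsto Ls atTop atTop →
      (∀ j, IsGroundStateInSector (hubbardTorusTT' (Ls j) 1 s₂ U₁) (rectN n (Ls j)) 0 (ψ (Ls j))) →
      (∀ j, star (ψ (Ls j)) ⬝ᵥ ψ (Ls j) = 1) → ω.IsTorusLimitOf ψ Ls →
      J₂₁ ≤ ω.meanEnergy (hubbardTTPrimeFermionInteraction 0 1 0) 1 ∧
        (ω.expect ({0} : Finset (Site 2))
          (nAt 0 (Finset.mem_singleton_self 0) 0 * nAt 0 (Finset.mem_singleton_self 0) 1)).re ≤ A₂₁)
    (h₂₂ : ∀ (ω : InfVolFermionState 2) (Ls : ℕ → ℕ) (ψ : ∀ L, Fock (Orb (FermionTorus 2 L))),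
      Tendsto Ls atTop atTop →
      (∀ j, IsGroundStateInSector (hubbardTorusTT' (Ls j) 1 s₂ U₂) (rectN n (Ls j)) 0 (ψ (Ls j))) →
      (∀ j, star (ψ (Ls j)) ⬝ᵥ ψ (Ls j) = 1) → ω.IsTorusLimitOf ψ Ls →
      J₂₂ ≤ ω.meanEnergy (hubbardTTPrimeFermionInteraction 0 1 0) 1 ∧
        B₂₂ ≤ (ω.expect ({0} : Finset (Site 2))
          (nAt 0 (Finset.mem_singleton_self 0) 0 * nAt 0 (Finset.mem_singleton_self 0) 1)).re)
    (hlo₁₁ : lo₁₁ ≤ dWaveSourceEnergyDensityTT' s₁ U₁ μ₀ h) (hlo₂₁ : lo₂₁ ≤ dWaveSourceEnergyDensityTT' s₂ U₁ μ₀ h)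
    (hlo₁₂ : lo₁₂ ≤ dWaveSourceEnergyDensityTT' s₁ U₂ μ₀ h) (hlo₂₂ : lo₂₂ ≤ dWaveSourceEnergyDensityTT' s₂ U₂ μ₀ h)
    {t' U : ℝ} (hs₁ : s₁ ≤ t') (hs₂ : t' ≤ s₂) (hU₁ : U₁ ≤ U) (hU₂ : U ≤ U₂) (t'' : ℝ) {ε : ℝ}
    {σ : InfVolFermionState 2} (hσ : σ.IsTranslationInvariant) (hρ : σ.density = n)
    (hε : σ.meanEnergy (hubbardTT'T''FermionInteraction 1 t' t'' U) 2 ≤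
      (hubbardTT'T''FermionInteraction 1 t' t'' U).tiGroundEnergyDensityAt 2 n + ε) :
    σ.meanEnergy (pairSourceInteraction dWaveFormFactor) 1 ≤
      (min (min (R₁₁ + K₁₁ * (t' - s₁) + A₁₁ * (U - U₁)) (R₁₂ + K₁₂ * (t' - s₁) - B₁₂ * (U₂ - U)))
          (min (R₂₁ - J₂₁ * (s₂ - t') + A₂₁ * (U - U₁)) (R₂₂ - J₂₂ * (s₂ - t') - B₂₂ * (U₂ - U))) - μ₀ * n -
        ((lo₁₁ + (lo₂₁ - lo₁₁) * (t' - s₁) / (s₂ - s₁)) +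
          ((lo₁₂ + (lo₂₂ - lo₁₂) * (t' - s₁) / (s₂ - s₁)) - (lo₁₁ + (lo₂₁ - lo₁₁) * (t' - s₁) / (s₂ - s₁))) *
            (U - U₁) / (U₂ - U₁)) +
        32 / Real.pi ^ 2 * |t''| + ε) / h :=
  meanEnergy_pairSource_le_of_cap_of_floor_filling t' (hU₁0.trans hU₁) hn0 hn2 hh μ₀
    (energyDensityTT'_rect_le_cornerPlanes_of_words 1 hU₁0 hs₁ hs₂ hU₁ hU₂ hn0.le hn2 hR₁₁ hR₂₁ hR₁₂ hR₂₂ h₁₁ h₁₂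
      h₂₁ h₂₂)
    (dWaveSourceEnergyDensityTT'_rect_ge_bilinear hs hUlt hs₁ hs₂ hU₁ hU₂ hlo₁₁ hlo₂₁ hlo₁₂ hlo₂₂) t'' hσ hρ hε

/-- **n-FORM, UNIFORM NESTED BULGE on the rectangle** (gaps `Rⱼᵢ − μ₀n − loⱼᵢ`): for every `(t',U)` in the
rectangle, `e_P(σ) ≤ (nested bulge + (32/π²)|t''| + ε)/h`. [cite: KomaTasaki1994, §1] -/
theorem meanEnergy_pairSource_le_nestedBulge_of_rect_filling {s₁ s₂ U₁ U₂ : ℝ} (hU₁0 : 0 ≤ U₁) (hs : s₁ < s₂)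
    (hUlt : U₁ < U₂) {n : ℝ} (hn0 : 0 < n) (hn2 : n < 2) {h : ℝ} (hh : 0 < h) (μ₀ : ℝ)
    {R₁₁ R₂₁ R₁₂ R₂₂ lo₁₁ lo₂₁ lo₁₂ lo₂₂ K₁₁ K₁₂ J₂₁ J₂₂ A₁₁ A₂₁ B₁₂ B₂₂ : ℝ}
    (hR₁₁ : energyDensityTT' 1 s₁ U₁ n ≤ R₁₁) (hR₂₁ : energyDensityTT' 1 s₂ U₁ n ≤ R₂₁)
    (hR₁₂ : energyDensityTT' 1 s₁ U₂ n ≤ R₁₂) (hR₂₂ : energyDensityTT' 1 s₂ U₂ n ≤ R₂₂)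
    (h₁₁ : ∀ (ω : InfVolFermionState 2) (Ls : ℕ → ℕ) (ψ : ∀ L, Fock (Orb (FermionTorus 2 L))),
      Tendsto Ls atTop atTop →
      (∀ j, IsGroundStateInSector (hubbardTorusTT' (Ls j) 1 s₁ U₁) (rectN n (Ls j)) 0 (ψ (Ls j))) →
      (∀ j, star (ψ (Ls j)) ⬝ᵥ ψ (Ls j) = 1) → ω.IsTorusLimitOf ψ Ls →
      ω.meanEnergy (hubbardTTPrimeFermionInteraction 0 1 0) 1 ≤ K₁₁ ∧
        (ω.expect ({0} : Finset (Site 2))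
          (nAt 0 (Finset.mem_singleton_self 0) 0 * nAt 0 (Finset.mem_singleton_self 0) 1)).re ≤ A₁₁)
    (h₁₂ : ∀ (ω : InfVolFermionState 2) (Ls : ℕ → ℕ) (ψ : ∀ L, Fock (Orb (FermionTorus 2 L))),
      Tendsto Ls atTop atTop →
      (∀ j, IsGroundStateInSector (hubbardTorusTT' (Ls j) 1 s₁ U₂) (rectN n (Ls j)) 0 (ψ (Ls j))) →
      (∀ j, star (ψ (Ls j)) ⬝ᵥ ψ (Ls j) = 1) → ω.IsTorusLimitOf ψ Ls →
      ω.meanEnergy (hubbardTTPrimeFermionInteraction 0 1 0) 1 ≤ K₁₂ ∧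
        B₁₂ ≤ (ω.expect ({0} : Finset (Site 2))
          (nAt 0 (Finset.mem_singleton_self 0) 0 * nAt 0 (Finset.mem_singleton_self 0) 1)).re)
    (h₂₁ : ∀ (ω : InfVolFermionState 2) (Ls : ℕ → ℕ) (ψ : ∀ L, Fock (Orb (FermionTorus 2 L))),
      Tendsto Ls atTop atTop →
      (∀ j, IsGroundStateInSector (hubbardTorusTT' (Ls j) 1 s₂ U₁) (rectN n (Ls j)) 0 (ψ (Ls j))) →
      (∀ j, star (ψ (Ls j)) ⬝ᵥ ψ (Ls j) = 1) → ω.IsTorusLimitOf ψ Ls →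
      J₂₁ ≤ ω.meanEnergy (hubbardTTPrimeFermionInteraction 0 1 0) 1 ∧
        (ω.expect ({0} : Finset (Site 2))
          (nAt 0 (Finset.mem_singleton_self 0) 0 * nAt 0 (Finset.mem_singleton_self 0) 1)).re ≤ A₂₁)
    (h₂₂ : ∀ (ω : InfVolFermionState 2) (Ls : ℕ → ℕ) (ψ : ∀ L, Fock (Orb (FermionTorus 2 L))),
      Tendsto Ls atTop atTop →
      (∀ j, IsGroundStateInSector (hubbardTorusTT' (Ls j) 1 s₂ U₂) (rectN n (Ls j)) 0 (ψ (Ls j))) →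
      (∀ j, star (ψ (Ls j)) ⬝ᵥ ψ (Ls j) = 1) → ω.IsTorusLimitOf ψ Ls →
      J₂₂ ≤ ω.meanEnergy (hubbardTTPrimeFermionInteraction 0 1 0) 1 ∧
        B₂₂ ≤ (ω.expect ({0} : Finset (Site 2))
          (nAt 0 (Finset.mem_singleton_self 0) 0 * nAt 0 (Finset.mem_singleton_self 0) 1)).re)
    (hlo₁₁ : lo₁₁ ≤ dWaveSourceEnergyDensityTT' s₁ U₁ μ₀ h) (hlo₂₁ : lo₂₁ ≤ dWaveSourceEnergyDensityTT' s₂ U₁ μ₀ h)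
    (hlo₁₂ : lo₁₂ ≤ dWaveSourceEnergyDensityTT' s₁ U₂ μ₀ h) (hlo₂₂ : lo₂₂ ≤ dWaveSourceEnergyDensityTT' s₂ U₂ μ₀ h)
    {t' U : ℝ} (hs₁ : s₁ ≤ t') (hs₂ : t' ≤ s₂) (hU₁ : U₁ ≤ U) (hU₂ : U ≤ U₂) (t'' : ℝ) {ε : ℝ}
    {σ : InfVolFermionState 2} (hσ : σ.IsTranslationInvariant) (hρ : σ.density = n)
    (hε : σ.meanEnergy (hubbardTT'T''FermionInteraction 1 t' t'' U) 2 ≤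
      (hubbardTT'T''FermionInteraction 1 t' t'' U).tiGroundEnergyDensityAt 2 n + ε) :
    σ.meanEnergy (pairSourceInteraction dWaveFormFactor) 1 ≤
      (max (max (R₁₁ - μ₀ * n - lo₁₁) (R₁₂ - μ₀ * n - lo₁₂) +
            (U₂ - U₁) *
              (max (A₁₁ - min ((lo₁₂ - lo₁₁) / (U₂ - U₁)) ((lo₂₂ - lo₂₁) / (U₂ - U₁))) 0 *
                max (max ((lo₁₂ - lo₁₁) / (U₂ - U₁)) ((lo₂₂ - lo₂₁) / (U₂ - U₁)) - B₁₂) 0) /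
              (max (A₁₁ - min ((lo₁₂ - lo₁₁) / (U₂ - U₁)) ((lo₂₂ - lo₂₁) / (U₂ - U₁))) 0 +
                max (max ((lo₁₂ - lo₁₁) / (U₂ - U₁)) ((lo₂₂ - lo₂₁) / (U₂ - U₁)) - B₁₂) 0))
          (max (R₂₁ - μ₀ * n - lo₂₁) (R₂₂ - μ₀ * n - lo₂₂) +
            (U₂ - U₁) *
              (max (A₂₁ - min ((lo₁₂ - lo₁₁) / (U₂ - U₁)) ((lo₂₂ - lo₂₁) / (U₂ - U₁))) 0 *
                max (max ((lo₁₂ - lo₁₁) / (U₂ - U₁)) ((lo₂₂ - lo₂₁) / (U₂ - U₁)) - B₂₂) 0) /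
              (max (A₂₁ - min ((lo₁₂ - lo₁₁) / (U₂ - U₁)) ((lo₂₂ - lo₂₁) / (U₂ - U₁))) 0 +
                max (max ((lo₁₂ - lo₁₁) / (U₂ - U₁)) ((lo₂₂ - lo₂₁) / (U₂ - U₁)) - B₂₂) 0)) +
        (s₂ - s₁) *
          (max (max (K₁₁ - (lo₂₁ - lo₁₁) / (s₂ - s₁)) (K₁₂ - (lo₂₂ - lo₁₂) / (s₂ - s₁))) 0 *
            max (max ((lo₂₁ - lo₁₁) / (s₂ - s₁) - J₂₁) ((lo₂₂ - lo₁₂) / (s₂ - s₁) - J₂₂)) 0) /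
          (max (max (K₁₁ - (lo₂₁ - lo₁₁) / (s₂ - s₁)) (K₁₂ - (lo₂₂ - lo₁₂) / (s₂ - s₁))) 0 +
            max (max ((lo₂₁ - lo₁₁) / (s₂ - s₁) - J₂₁) ((lo₂₂ - lo₁₂) / (s₂ - s₁) - J₂₂)) 0) +
        32 / Real.pi ^ 2 * |t''| + ε) / h := by
  refine (meanEnergy_pairSource_le_of_rect_filling hU₁0 hs hUlt hn0 hn2 hh μ₀ hR₁₁ hR₂₁ hR₁₂ hR₂₂ h₁₁ h₁₂ h₂₁ h₂₂
    hlo₁₁ hlo₂₁ hlo₁₂ hlo₂₂ hs₁ hs₂ hU₁ hU₂ t'' hσ hρ hε).trans (div_le_div_of_nonneg_right ?_ hh.le)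
  have hb := min_cornerPlanes_sub_bilinear_le_nestedBulge (hi₁₁ := R₁₁ - μ₀ * n) (hi₂₁ := R₂₁ - μ₀ * n)
    (hi₁₂ := R₁₂ - μ₀ * n) (hi₂₂ := R₂₂ - μ₀ * n) (lo₁₁ := lo₁₁) (lo₂₁ := lo₂₁) (lo₁₂ := lo₁₂) (lo₂₂ := lo₂₂)
    (K₁₁ := K₁₁) (K₁₂ := K₁₂) (J₂₁ := J₂₁) (J₂₂ := J₂₂) (A₁₁ := A₁₁) (A₂₁ := A₂₁) (B₁₂ := B₁₂) (B₂₂ := B₂₂)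
    hs hUlt hs₁ hs₂ hU₁ hU₂
  have e : min (min (R₁₁ + K₁₁ * (t' - s₁) + A₁₁ * (U - U₁)) (R₁₂ + K₁₂ * (t' - s₁) - B₁₂ * (U₂ - U)))
        (min (R₂₁ - J₂₁ * (s₂ - t') + A₂₁ * (U - U₁)) (R₂₂ - J₂₂ * (s₂ - t') - B₂₂ * (U₂ - U))) - μ₀ * n =
      min (min (R₁₁ - μ₀ * n + K₁₁ * (t' - s₁) + A₁₁ * (U - U₁)) (R₁₂ - μ₀ * n + K₁₂ * (t' - s₁) - B₁₂ * (U₂ - U)))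
        (min (R₂₁ - μ₀ * n - J₂₁ * (s₂ - t') + A₂₁ * (U - U₁))
          (R₂₂ - μ₀ * n - J₂₂ * (s₂ - t') - B₂₂ * (U₂ - U))) := by
    rw [← min_sub_sub_right, ← min_sub_sub_right, ← min_sub_sub_right]
    congr 1 <;> congr 1 <;> ring
  linarith [hb, e]

/-- **n-FORM ABSENT(`< m₀`) FOR OBJECT M ON A WHOLE `(t', U)` RECTANGLE**: if `nested bulge + (32/π²)|t''| < h·m₀`
(gaps `Rⱼᵢ − μ₀n − loⱼᵢ`) then no translation-invariant canonical minimiser of object M (density `n`) at any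
`(1,t',t'',U)` with `(t',U)` in the rectangle has `d`-wave pair amplitude `≥ m₀`. [cite: KomaTasaki1994, §1] -/
theorem meanEnergy_pairSource_lt_on_rect_filling {s₁ s₂ U₁ U₂ : ℝ} (hU₁0 : 0 ≤ U₁) (hs : s₁ < s₂)
    (hUlt : U₁ < U₂) {n : ℝ} (hn0 : 0 < n) (hn2 : n < 2) {h : ℝ} (hh : 0 < h) (μ₀ : ℝ)
    {R₁₁ R₂₁ R₁₂ R₂₂ lo₁₁ lo₂₁ lo₁₂ lo₂₂ K₁₁ K₁₂ J₂₁ J₂₂ A₁₁ A₂₁ B₁₂ B₂₂ m₀ : ℝ}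
    (hR₁₁ : energyDensityTT' 1 s₁ U₁ n ≤ R₁₁) (hR₂₁ : energyDensityTT' 1 s₂ U₁ n ≤ R₂₁)
    (hR₁₂ : energyDensityTT' 1 s₁ U₂ n ≤ R₁₂) (hR₂₂ : energyDensityTT' 1 s₂ U₂ n ≤ R₂₂)
    (h₁₁ : ∀ (ω : InfVolFermionState 2) (Ls : ℕ → ℕ) (ψ : ∀ L, Fock (Orb (FermionTorus 2 L))),
      Tendsto Ls atTop atTop →
      (∀ j, IsGroundStateInSector (hubbardTorusTT' (Ls j) 1 s₁ U₁) (rectN n (Ls j)) 0 (ψ (Ls j))) →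
      (∀ j, star (ψ (Ls j)) ⬝ᵥ ψ (Ls j) = 1) → ω.IsTorusLimitOf ψ Ls →
      ω.meanEnergy (hubbardTTPrimeFermionInteraction 0 1 0) 1 ≤ K₁₁ ∧
        (ω.expect ({0} : Finset (Site 2))
          (nAt 0 (Finset.mem_singleton_self 0) 0 * nAt 0 (Finset.mem_singleton_self 0) 1)).re ≤ A₁₁)
    (h₁₂ : ∀ (ω : InfVolFermionState 2) (Ls : ℕ → ℕ) (ψ : ∀ L, Fock (Orb (FermionTorus 2 L))),
      Tendsto Ls atTop atTop →
      (∀ j, IsGroundStateInSector (hubbardTorusTT' (Ls j) 1 s₁ U₂) (rectN n (Ls j)) 0 (ψ (Ls j))) →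
      (∀ j, star (ψ (Ls j)) ⬝ᵥ ψ (Ls j) = 1) → ω.IsTorusLimitOf ψ Ls →
      ω.meanEnergy (hubbardTTPrimeFermionInteraction 0 1 0) 1 ≤ K₁₂ ∧
        B₁₂ ≤ (ω.expect ({0} : Finset (Site 2))
          (nAt 0 (Finset.mem_singleton_self 0) 0 * nAt 0 (Finset.mem_singleton_self 0) 1)).re)
    (h₂₁ : ∀ (ω : InfVolFermionState 2) (Ls : ℕ → ℕ) (ψ : ∀ L, Fock (Orb (FermionTorus 2 L))),
      Tendsto Ls atTop atTop →
      (∀ j, IsGroundStateInSector (hubbardTorusTT' (Ls j) 1 s₂ U₁) (rectN n (Ls j)) 0 (ψ (Ls j))) →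
      (∀ j, star (ψ (Ls j)) ⬝ᵥ ψ (Ls j) = 1) → ω.IsTorusLimitOf ψ Ls →
      J₂₁ ≤ ω.meanEnergy (hubbardTTPrimeFermionInteraction 0 1 0) 1 ∧
        (ω.expect ({0} : Finset (Site 2))
          (nAt 0 (Finset.mem_singleton_self 0) 0 * nAt 0 (Finset.mem_singleton_self 0) 1)).re ≤ A₂₁)
    (h₂₂ : ∀ (ω : InfVolFermionState 2) (Ls : ℕ → ℕ) (ψ : ∀ L, Fock (Orb (FermionTorus 2 L))),
      Tendsto Ls atTop atTop →
      (∀ j, IsGroundStateInSector (hubbardTorusTT' (Ls j) 1 s₂ U₂) (rectN n (Ls j)) 0 (ψ (Ls j))) →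
      (∀ j, star (ψ (Ls j)) ⬝ᵥ ψ (Ls j) = 1) → ω.IsTorusLimitOf ψ Ls →
      J₂₂ ≤ ω.meanEnergy (hubbardTTPrimeFermionInteraction 0 1 0) 1 ∧
        B₂₂ ≤ (ω.expect ({0} : Finset (Site 2))
          (nAt 0 (Finset.mem_singleton_self 0) 0 * nAt 0 (Finset.mem_singleton_self 0) 1)).re)
    (hlo₁₁ : lo₁₁ ≤ dWaveSourceEnergyDensityTT' s₁ U₁ μ₀ h) (hlo₂₁ : lo₂₁ ≤ dWaveSourceEnergyDensityTT' s₂ U₁ μ₀ h)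
    (hlo₁₂ : lo₁₂ ≤ dWaveSourceEnergyDensityTT' s₁ U₂ μ₀ h) (hlo₂₂ : lo₂₂ ≤ dWaveSourceEnergyDensityTT' s₂ U₂ μ₀ h)
    {t'' : ℝ}
    (hnear : max (max (R₁₁ - μ₀ * n - lo₁₁) (R₁₂ - μ₀ * n - lo₁₂) +
            (U₂ - U₁) *
              (max (A₁₁ - min ((lo₁₂ - lo₁₁) / (U₂ - U₁)) ((lo₂₂ - lo₂₁) / (U₂ - U₁))) 0 *
                max (max ((lo₁₂ - lo₁₁) / (U₂ - U₁)) ((lo₂₂ - lo₂₁) / (U₂ - U₁)) - B₁₂) 0) /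
              (max (A₁₁ - min ((lo₁₂ - lo₁₁) / (U₂ - U₁)) ((lo₂₂ - lo₂₁) / (U₂ - U₁))) 0 +
                max (max ((lo₁₂ - lo₁₁) / (U₂ - U₁)) ((lo₂₂ - lo₂₁) / (U₂ - U₁)) - B₁₂) 0))
          (max (R₂₁ - μ₀ * n - lo₂₁) (R₂₂ - μ₀ * n - lo₂₂) +
            (U₂ - U₁) *
              (max (A₂₁ - min ((lo₁₂ - lo₁₁) / (U₂ - U₁)) ((lo₂₂ - lo₂₁) / (U₂ - U₁))) 0 *
                max (max ((lo₁₂ - lo₁₁) / (U₂ - U₁)) ((lo₂₂ - lo₂₁) / (U₂ - U₁)) - B₂₂) 0) /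
              (max (A₂₁ - min ((lo₁₂ - lo₁₁) / (U₂ - U₁)) ((lo₂₂ - lo₂₁) / (U₂ - U₁))) 0 +
                max (max ((lo₁₂ - lo₁₁) / (U₂ - U₁)) ((lo₂₂ - lo₂₁) / (U₂ - U₁)) - B₂₂) 0)) +
        (s₂ - s₁) *
          (max (max (K₁₁ - (lo₂₁ - lo₁₁) / (s₂ - s₁)) (K₁₂ - (lo₂₂ - lo₁₂) / (s₂ - s₁))) 0 *
            max (max ((lo₂₁ - lo₁₁) / (s₂ - s₁) - J₂₁) ((lo₂₂ - lo₁₂) / (s₂ - s₁) - J₂₂)) 0) /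
          (max (max (K₁₁ - (lo₂₁ - lo₁₁) / (s₂ - s₁)) (K₁₂ - (lo₂₂ - lo₁₂) / (s₂ - s₁))) 0 +
            max (max ((lo₂₁ - lo₁₁) / (s₂ - s₁) - J₂₁) ((lo₂₂ - lo₁₂) / (s₂ - s₁) - J₂₂)) 0) +
        32 / Real.pi ^ 2 * |t''| < h * m₀)
    {t' U : ℝ} (hs₁ : s₁ ≤ t') (hs₂ : t' ≤ s₂) (hU₁ : U₁ ≤ U) (hU₂ : U ≤ U₂) {σ : InfVolFermionState 2}
    (hσ : σ.IsTranslationInvariant) (hρ : σ.density = n)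
    (hmin : σ.meanEnergy (hubbardTT'T''FermionInteraction 1 t' t'' U) 2 ≤
      (hubbardTT'T''FermionInteraction 1 t' t'' U).tiGroundEnergyDensityAt 2 n) :
    σ.meanEnergy (pairSourceInteraction dWaveFormFactor) 1 < m₀ := by
  have hk := meanEnergy_pairSource_le_nestedBulge_of_rect_filling (ε := 0) hU₁0 hs hUlt hn0 hn2 hh μ₀ hR₁₁ hR₂₁
    hR₁₂ hR₂₂ h₁₁ h₁₂ h₂₁ h₂₂ hlo₁₁ hlo₂₁ hlo₁₂ hlo₂₂ hs₁ hs₂ hU₁ hU₂ t'' hσ hρ (by rw [add_zero]; exact hmin)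
  rw [add_zero] at hk
  refine hk.trans_lt ?_
  rw [div_lt_iff₀ hh]
  linarith [hnear]

end Rect

end Literature.MathematicalPhysics.QuantumLattice

end
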